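import Summits.CriticalPhenomena.PercolationContinuityZ3.Theorems.PercNearOneGluingNoHeavyLowerTailHullPortKNQuestion9Three
import Summits.CriticalPhenomena.PercolationContinuityZ3.Theorems.PercNearOneGluingNoHeavyLowerTailFaceIIAtomExchange
import Summits.CriticalPhenomena.PercolationContinuityZ3.Theorems.PercNearOneGluingAdditiveGluingFingerSetForm
import HarnessLib

/-!
# `NoHeavyLowerTail` (stmt-CriticalPhenomena-4575) — the glued Question-9 ROW for a face atom, from the tree theorem
# `HullPort.kn_question9_three`, and the regime-II exchange inequality from rankings in the UNGLUED graph `K_u`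

Support file (lemma factory `prim-lf-3` gen 15; `--supports stmt-CriticalPhenomena-4575`).  No definitions, no named facts, no sorries.
Memo: `run/shared/lean/prim/prim-lf-3/LF3-BETA-R.md` §18b.

Kozma–Nitzan's Question 9 at three relays is a tree theorem in the set-observer wording (`HullPort.kn_question9_three`, hp-7 gen 31 on
the coupling seat's chain, 2026-08-20): for an observer SET `N ∌ b` and relays `x, y, z` with `z` the least `b`-reliable IN THE GRAPH ITSELF,
`μ(({z↔b} ∪ ({N↔z} ∩ {N↔b})) ∩ {N↔{x,y,z}}) ≤ μ({N↔b} ∩ {N↔{x,y,z}})`.  THIS FILE rewrites it in the glued graph `glue_Y w` (all pairs inside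
the block `Y` sure) used by the face atoms — the gluing push-forward `ω ↦ ω ∪ clique(Y)` (`glueSet_pushforward`) and the last-exit lemma
`reachable_or_exists_mem_of_glue` identify `{s₀ ↔ v}_{glue_Y w}` with `{Y ↔ v}` and `{c ↔ b}_{glue_Y w}` with `{c↔b} ∪ ({Y↔c} ∩ {Y↔b})`:

* `gluedQ9_row` — for `s₀ ∈ Y ∌ b`, relays `c, d, j ≠ b` distinct with `μ_w(cb) ≤ μ_w(db)`, `μ_w(cb) ≤ μ_w(jb)` (rankings in `w`, NOT in the
  glued graph): `μ_{glue_Y w}(cb ∩ U) ≤ μ_{glue_Y w}(s₀b ∩ U)`, `U = {s₀↔d} ∪ {s₀↔j} ∪ {s₀↔c}`.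
* `exchangeII_of_unglued_ranking` — for the mixture `K_u = (1−u)·w + u·w[cd↦1]` (the genuine graph `w` with the pair `cd` raised): if `c` is the
  least `b`-reliable of `c, d, j` in `K_u`, then at EVERY block `Y ∌ b, c, d` and every `s₀ ∈ Y` the regime-II exchange inequality
  `μ(cb) − μ(s₀b) ≤ μ((cb ∪ db), s₀ ≁ b,c,d,j) − μ(s₀b, c↮b, d↮b, (jc ∪ jd))` holds in `K_u/Y = (1−u)·glue_Y w + u·glue_Y w[cd↦1]` (mixture form)
  — the hypothesis `hexII` of `face_regimeII_of_exchange` / `kernel_twoPlusStar_regimeII_of_exchange`, with NO ranking in `K_u/Y`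
  (`gluedQ9_row` for the raised graph, `glue_modifyPair_comm`, `real_raisePair_eq_mix`, `spectatorExchange_of_gluedQ9`).
So the anchoring proviso of regime II (memo §16e) is gone: see `…AnchoredRegimeII` for the face and kernel theorems.
[cite: KozmaNitzan2024, Question 9 (p. 36), (41) (p. 36), Lemma 5 (p. 13), (9) (pp. 9–10)]
-/

namespace Summit.CriticalPhenomena.PercolationContinuityZ3.Theorems

open MeasureTheory Set ProbabilityTheory
open Literature.Probability.LatticeModels
open Literature.Probability.Percolation

noncomputable section
open Classical

namespace UpsetExchange

variable {n : ℕ}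

/-- **The glued Question-9 row.**  For a block `Y ∌ b` with `s₀ ∈ Y` and distinct relays `c, d, j ≠ b` with `μ_w(cb) ≤ μ_w(db)`,
`μ_w(cb) ≤ μ_w(jb)` (rankings in the unglued graph `w`): in `glue_Y w`, `μ(cb ∩ U) ≤ μ(s₀b ∩ U)` for `U = {s₀↔d} ∪ {s₀↔j} ∪ {s₀↔c}`.
(`HullPort.kn_question9_three` with `N = Y`, transported along `ω ↦ ω ∪ clique(Y)`.)
[cite: KozmaNitzan2024, Question 9 (p. 36), (41) (p. 36)] -/
theorem gluedQ9_row (w : Sym2 (Fin n) → unitInterval) (Y : Finset (Fin n)) (c d j b s₀ : Fin n)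
    (hs₀ : s₀ ∈ Y) (hbY : b ∉ Y) (hcb : c ≠ b) (hdb : d ≠ b) (hjb : j ≠ b) (hcd : c ≠ d) (hcj : c ≠ j) (hdj : d ≠ j)
    (hcdw : (prodBernoulli w).real (openConn c b) ≤ (prodBernoulli w).real (openConn d b))
    (hcjw : (prodBernoulli w).real (openConn c b) ≤ (prodBernoulli w).real (openConn j b)) :
    (prodBernoulli (fun e : Sym2 (Fin n) => if (∀ x ∈ e, x ∈ Y) ∧ ¬ e.IsDiag then 1 else w e)).real
        (openConn c b ∩ (openConn s₀ d ∪ openConn s₀ j ∪ openConn s₀ c)) ≤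
      (prodBernoulli (fun e : Sym2 (Fin n) => if (∀ x ∈ e, x ∈ Y) ∧ ¬ e.IsDiag then 1 else w e)).real
        (openConn s₀ b ∩ (openConn s₀ d ∪ openConn s₀ j ∪ openConn s₀ c)) := by
  set L : Sym2 (Fin n) → unitInterval := fun e => if (∀ x ∈ e, x ∈ Y) ∧ ¬ e.IsDiag then 1 else w e with hL
  set C : Set (Sym2 (Fin n)) := {e : Sym2 (Fin n) | (∀ x ∈ e, x ∈ Y) ∧ ¬ e.IsDiag} with hC
  -- Question 9 at three relays in `w`, observer set `Y`, relays `d, j, c`, designated `c`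
  have hbN : b ∉ (↑Y : Set (Fin n)) := fun h => hbY (Finset.mem_coe.1 h)
  have key := HullPort.kn_question9_three w (↑Y : Set (Fin n)) b d j c hbN hdb hjb hcb hdj (Ne.symm hcd) (Ne.symm hcj) hcdw hcjw
  -- the gluing push-forward
  have hpush : ∀ G : Set (BondConfig (Fin n)), (prodBernoulli L).real G =
      (prodBernoulli w).real {ω : BondConfig (Fin n) | ((ω ∪ C : Set (Sym2 (Fin n))) : BondConfig (Fin n)) ∈ G} :=
    fun G => glueSet_pushforward w L C (fun e he => by simp only [hL, hC, mem_setOf_eq] at he ⊢; rw [if_pos he])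
      (fun e he => by simp only [hL, hC, mem_setOf_eq] at he ⊢; rw [if_neg he]) G
  -- reachability after gluing: from a block vertex, and between two outside vertices
  set NY : Fin n → Set (BondConfig (Fin n)) := fun v => {ω : BondConfig (Fin n) | ∃ m ∈ (↑Y : Set (Fin n)), (openGraph ω).Reachable m v}
    with hNY
  have hblock : ∀ (v : Fin n) (ω : BondConfig (Fin n)),
      (openGraph ((ω ∪ C : Set (Sym2 (Fin n))) : BondConfig (Fin n))).Reachable s₀ v ↔ ω ∈ NY v := by
    intro v ω
    constructor
    · intro h
      rcases reachable_or_exists_mem_of_glue Y h with h1 | ⟨m, hm, hmv⟩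
      · exact ⟨s₀, Finset.mem_coe.2 hs₀, h1⟩
      · exact ⟨m, Finset.mem_coe.2 hm, hmv⟩
    · rintro ⟨m, hm, hmv⟩
      exact (reachable_glue_of_mem Y hs₀ (Finset.mem_coe.1 hm)).trans (reachable_glue_mono Y hmv)
  have hout : ∀ (v v' : Fin n) (ω : BondConfig (Fin n)),
      (openGraph ((ω ∪ C : Set (Sym2 (Fin n))) : BondConfig (Fin n))).Reachable v v' ↔
        ((openGraph ω).Reachable v v' ∨ (ω ∈ NY v ∧ ω ∈ NY v')) := by
    intro v v' ω
    constructor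
    · intro h
      rcases reachable_or_exists_mem_of_glue Y h with h1 | ⟨m, hm, hmv'⟩
      · exact Or.inl h1
      · rcases reachable_or_exists_mem_of_glue Y h.symm with h2 | ⟨m', hm', hm'v⟩
        · exact Or.inl h2.symm
        · exact Or.inr ⟨⟨m', Finset.mem_coe.2 hm', hm'v⟩, ⟨m, Finset.mem_coe.2 hm, hmv'⟩⟩
    · rintro (h | ⟨⟨m, hm, hmv⟩, ⟨m', hm', hm'v'⟩⟩)
      · exact reachable_glue_mono Y h
      · exact ((reachable_glue_mono Y hmv).symm.trans
          (reachable_glue_of_mem Y (Finset.mem_coe.1 hm) (Finset.mem_coe.1 hm'))).trans (reachable_glue_mono Y hm'v')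
  -- the two pull-backs
  simp only [Finset.set_biUnion_insert, Finset.set_biUnion_singleton] at key
  have hU : ∀ ω : BondConfig (Fin n),
      (((ω ∪ C : Set (Sym2 (Fin n))) : BondConfig (Fin n)) ∈ (openConn s₀ d ∪ openConn s₀ j ∪ openConn s₀ c : Set (BondConfig (Fin n)))) ↔
        ω ∈ NY d ∪ (NY j ∪ NY c) := by
    intro ω
    simp only [mem_union]
    rw [← hblock d ω, ← hblock j ω, ← hblock c ω]
    constructor
    · rintro ((h | h) | h)
      · exact Or.inl h
      · exact Or.inr (Or.inl h)
      · exact Or.inr (Or.inr h)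
    · rintro (h | h | h)
      · exact Or.inl (Or.inl h)
      · exact Or.inl (Or.inr h)
      · exact Or.inr h
  have hE1 : {ω : BondConfig (Fin n) | ((ω ∪ C : Set (Sym2 (Fin n))) : BondConfig (Fin n)) ∈
        (openConn c b ∩ (openConn s₀ d ∪ openConn s₀ j ∪ openConn s₀ c) : Set (BondConfig (Fin n)))} =
      (openConn c b ∪ (NY c ∩ NY b)) ∩ (NY d ∪ (NY j ∪ NY c)) := by
    ext ω
    simp only [mem_setOf_eq]
    rw [mem_inter_iff, mem_inter_iff, ← hU ω]
    constructor
    · rintro ⟨h1, h2⟩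
      exact ⟨(hout c b ω).1 h1, h2⟩
    · rintro ⟨h1, h2⟩
      exact ⟨(hout c b ω).2 h1, h2⟩
  have hE2 : {ω : BondConfig (Fin n) | ((ω ∪ C : Set (Sym2 (Fin n))) : BondConfig (Fin n)) ∈
        (openConn s₀ b ∩ (openConn s₀ d ∪ openConn s₀ j ∪ openConn s₀ c) : Set (BondConfig (Fin n)))} =
      NY b ∩ (NY d ∪ (NY j ∪ NY c)) := by
    ext ω
    simp only [mem_setOf_eq]
    rw [mem_inter_iff, mem_inter_iff, ← hU ω]
    constructor
    · rintro ⟨h1, h2⟩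
      exact ⟨(hblock b ω).1 h1, h2⟩
    · rintro ⟨h1, h2⟩
      exact ⟨(hblock b ω).2 h1, h2⟩
  rw [hpush, hpush, hE1, hE2]
  exact key

/-- **The regime-II exchange inequality at every atom, from rankings in the UNGLUED graph `K_u`.**  Let `K_u = (1−u)·w + u·w[cd↦1]`
(mixture form) and suppose `c` is the least `b`-reliable of `c, d, j` in `K_u`.  Then for every block `Y ∌ b, c, d` and every `s₀ ∈ Y`,
in the mixture `K_u/Y = (1−u)·L + u·M` (`L = glue_Y w`, `M = L[cd↦1]`):
`μ(cb) − μ(s₀b) ≤ μ((cb ∪ db), s₀ ≁ b,c,d,j) − μ(s₀b, c↮b, d↮b, (jc ∪ jd))`.  (The hypothesis `hexII`, exchange branch, of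
`face_regimeII_of_exchange`.)  [cite: KozmaNitzan2024, Question 9 (p. 36), (9) (pp. 9–10), Lemma 5 (p. 13)] -/
theorem exchangeII_of_unglued_ranking (w : Sym2 (Fin n) → unitInterval) (Y : Finset (Fin n)) (c d j b s₀ : Fin n) (u : unitInterval)
    (hs₀ : s₀ ∈ Y) (hbY : b ∉ Y) (hcY : c ∉ Y) (hcb : c ≠ b) (hdb : d ≠ b) (hjb : j ≠ b) (hcd : c ≠ d) (hcj : c ≠ j) (hdj : d ≠ j)
    (hcdu : (1 - (u : ℝ)) * (prodBernoulli w).real (openConn c b) +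
        (u : ℝ) * (prodBernoulli (fun f : Sym2 (Fin n) => if f = s(c, d) then 1 else w f)).real (openConn c b) ≤
      (1 - (u : ℝ)) * (prodBernoulli w).real (openConn d b) +
        (u : ℝ) * (prodBernoulli (fun f : Sym2 (Fin n) => if f = s(c, d) then 1 else w f)).real (openConn d b))
    (hcju : (1 - (u : ℝ)) * (prodBernoulli w).real (openConn c b) +
        (u : ℝ) * (prodBernoulli (fun f : Sym2 (Fin n) => if f = s(c, d) then 1 else w f)).real (openConn c b) ≤
      (1 - (u : ℝ)) * (prodBernoulli w).real (openConn j b) +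
        (u : ℝ) * (prodBernoulli (fun f : Sym2 (Fin n) => if f = s(c, d) then 1 else w f)).real (openConn j b)) :
    ((1 - (u : ℝ)) * (prodBernoulli (fun e : Sym2 (Fin n) => if (∀ x ∈ e, x ∈ Y) ∧ ¬ e.IsDiag then 1 else w e)).real (openConn c b) +
          (u : ℝ) * (prodBernoulli (fun f : Sym2 (Fin n) => if f = s(c, d) then 1 else
            (if (∀ x ∈ f, x ∈ Y) ∧ ¬ f.IsDiag then 1 else w f))).real (openConn c b)) -
        ((1 - (u : ℝ)) * (prodBernoulli (fun e : Sym2 (Fin n) => if (∀ x ∈ e, x ∈ Y) ∧ ¬ e.IsDiag then 1 else w e)).real (openConn s₀ b) +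
          (u : ℝ) * (prodBernoulli (fun f : Sym2 (Fin n) => if f = s(c, d) then 1 else
            (if (∀ x ∈ f, x ∈ Y) ∧ ¬ f.IsDiag then 1 else w f))).real (openConn s₀ b)) ≤
      ((1 - (u : ℝ)) * (prodBernoulli (fun e : Sym2 (Fin n) => if (∀ x ∈ e, x ∈ Y) ∧ ¬ e.IsDiag then 1 else w e)).real
            ((openConn c b ∪ openConn d b) ∩ (openConn s₀ b)ᶜ ∩ (openConn s₀ c)ᶜ ∩ (openConn s₀ d)ᶜ ∩ (openConn s₀ j)ᶜ) +
          (u : ℝ) * (prodBernoulli (fun f : Sym2 (Fin n) => if f = s(c, d) then 1 else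
            (if (∀ x ∈ f, x ∈ Y) ∧ ¬ f.IsDiag then 1 else w f))).real
            ((openConn c b ∪ openConn d b) ∩ (openConn s₀ b)ᶜ ∩ (openConn s₀ c)ᶜ ∩ (openConn s₀ d)ᶜ ∩ (openConn s₀ j)ᶜ)) -
        ((1 - (u : ℝ)) * (prodBernoulli (fun e : Sym2 (Fin n) => if (∀ x ∈ e, x ∈ Y) ∧ ¬ e.IsDiag then 1 else w e)).real
            (openConn s₀ b ∩ (openConn c b)ᶜ ∩ (openConn d b)ᶜ ∩ (openConn j c ∪ openConn j d)) +
          (u : ℝ) * (prodBernoulli (fun f : Sym2 (Fin n) => if f = s(c, d) then 1 else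
            (if (∀ x ∈ f, x ∈ Y) ∧ ¬ f.IsDiag then 1 else w f))).real
            (openConn s₀ b ∩ (openConn c b)ᶜ ∩ (openConn d b)ᶜ ∩ (openConn j c ∪ openConn j d))) := by
  set L : Sym2 (Fin n) → unitInterval := fun e => if (∀ x ∈ e, x ∈ Y) ∧ ¬ e.IsDiag then 1 else w e with hL
  set M : Sym2 (Fin n) → unitInterval := fun f => if f = s(c, d) then 1 else L f with hM
  set R : Sym2 (Fin n) → unitInterval := fun f => if f = s(c, d) then Set.Icc.convexComb (L s(c, d)) 1 u else L f with hR
  -- the raised (unglued) graph `R₀ = K_u` and its mixture identity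
  set R₀ : Sym2 (Fin n) → unitInterval := fun f => if f = s(c, d) then Set.Icc.convexComb (w s(c, d)) 1 u else w f with hR₀
  have hmixw : ∀ X : Set (BondConfig (Fin n)), (prodBernoulli R₀).real X =
      (1 - (u : ℝ)) * (prodBernoulli w).real X +
        (u : ℝ) * (prodBernoulli (fun f : Sym2 (Fin n) => if f = s(c, d) then 1 else w f)).real X :=
    fun X => real_raisePair_eq_mix w s(c, d) u X
  have hmixL : ∀ X : Set (BondConfig (Fin n)), (prodBernoulli R).real X =
      (1 - (u : ℝ)) * (prodBernoulli L).real X + (u : ℝ) * (prodBernoulli M).real X :=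
    fun X => real_raisePair_eq_mix L s(c, d) u X
  -- rankings in `R₀`
  have hcd' : (prodBernoulli R₀).real (openConn c b) ≤ (prodBernoulli R₀).real (openConn d b) := by
    rw [hmixw, hmixw]; exact hcdu
  have hcj' : (prodBernoulli R₀).real (openConn c b) ≤ (prodBernoulli R₀).real (openConn j b) := by
    rw [hmixw, hmixw]; exact hcju
  -- the glued Question-9 row in `glue_Y R₀ = R`
  have hrow := gluedQ9_row R₀ Y c d j b s₀ hs₀ hbY hcb hdb hjb hcd hcj hdj hcd' hcj'
  have hswapR : (fun e : Sym2 (Fin n) => if (∀ x ∈ e, x ∈ Y) ∧ ¬ e.IsDiag then 1 else R₀ e) = R := by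
    have h := glue_modifyPair_comm w Y (c := c) (d := d) hcY (fun t => Set.Icc.convexComb t 1 u)
    simpa only [hR₀, hR, hL] using h
  rw [hswapR] at hrow
  -- the exchange inequality in `R`, then the mixture form
  have key := spectatorExchange_of_gluedQ9 R b s₀ j c d hrow
  rw [hmixL, hmixL, hmixL, hmixL] at key
  exact key

end UpsetExchange

end

end Summit.CriticalPhenomena.PercolationContinuityZ3.Theorems
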